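import Literature.AlgebraicGeometry.Resolution.FrobeniusNormIdeal
import Literature.AlgebraicGeometry.Resolution.FFinite
import Mathlib.LinearAlgebra.Basis.SMul
import Mathlib.LinearAlgebra.Dimension.Finite
import Mathlib.Algebra.BigOperators.Group.Finset.Piecewise
import Mathlib.Algebra.Group.Submonoid.BigOperators
import HarnessLib

/-!
# F-finite domains have Frobenius norm ideals

Topic: `Literature/AlgebraicGeometry/Resolution`. PROVED: if the domain `A` with fraction field
`K` of characteristic `p` is F-finite at level `e` (`IsFFinite p e A`, `FFinite.lean`:
`A = ∑ᵢ A^q sᵢ`, `q = p^e`), then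

* `IsFFinite.finite_iterateFrobeniusRange` — `[K : K^q] < ∞` (`K` is spanned over `K^q` by the
  `sᵢ`);
* `IsFFinite.frobeniusNorm_le_span` — the Frobenius norm `[[F^e_* A]]_β` (`FrobeniusNormIdeal.lean`)
  is contained in the `A`-span of the finitely many `q`-th roots `d_σ` of the determinants
  `det_β(s ∘ σ)`, `σ : ι → Fin n` (expand `det_β(∑ᵢ c_{ji}^q sᵢ)ⱼ` multilinearly; the coefficients
  `∏ⱼ c_{jσ(j)}^q` are `q`-th powers, i.e. scalars of `K^q`), in particular it is a fractional
  ideal with a common denominator (`IsFFinite.exists_denominator_frobeniusNorm`);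
* `IsFFinite.exists_isFrobeniusNormIdeal` — **some ideal `I ⊆ A` is a Frobenius norm ideal**
  (`IsFrobeniusNormIdeal K p e I`): rescale the basis `β` by the unit `(D^q)⁻¹ ∈ K^q`, `D` a common
  denominator, so that the norm moves into `A` (`frobeniusNorm_basis_change`).

This is the finiteness half of "`𝒪_X^{1/q}` is coherent, so its universal flattening / the
blow-up at it exists" (Yasuda 2012, §2.1; Villamayor 2006, Thm. 3.3 for finitely generated
modules) and feeds `HasFrobeniusNormIdeals` (`FBlowupExistence.lean`).

## Sources

* O. Villamayor U., J. Algebra 295 (2006) 119–140, §2 (the norm of a finitely generated module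
  is a fractional ideal), Thm. 3.3. [Villamayoru2006]
* E. Kunz, Amer. J. Math. 91 (1969), §1–2 (F-finiteness). [Kunz1969]
-/

noncomputable section

open Module

namespace Literature.AlgebraicGeometry.Resolution

universe u v

variable {K : Type u} [Field K] {p : ℕ} [ExpChar K p] {e : ℕ}
variable {A : Type v} [CommRing A] [IsDomain A] [Algebra A K] [IsFractionRing A K]

/-- **An F-finite domain has an F-finite fraction field**: `[K : K^q] < ∞`, `K` being spanned
over `K^q` by generators of `A` over `A^q`. [cite: Kunz1969, §1] -/
theorem IsFFinite.finite_iterateFrobeniusRange (h : IsFFinite p e A) :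
    Module.Finite (iterateFrobeniusRange K p e) K := by
  obtain ⟨n, s, hs⟩ := h
  refine Module.finite_def.mpr (Submodule.fg_def.mpr
    ⟨Set.range fun i => algebraMap A K (s i), Set.finite_range _, ?_⟩)
  rw [eq_top_iff, ← span_range_algebraMap_eq_top (A := A), Submodule.span_le]
  rintro _ ⟨a, rfl⟩
  obtain ⟨c, hc⟩ := hs a
  rw [SetLike.mem_coe, hc, map_sum]
  refine Submodule.sum_mem _ fun i _ => ?_
  rw [map_mul, map_pow]
  have : algebraMap A K (c i) ^ p ^ e * algebraMap A K (s i) =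
      (⟨algebraMap A K (c i) ^ p ^ e, pow_mem_iterateFrobeniusRange _⟩ :
        iterateFrobeniusRange K p e) • algebraMap A K (s i) := by
    rw [Algebra.smul_def, Subfield.algebraMap_ofSubfield]
    rfl
  rw [this]
  exact Submodule.smul_mem _ _ (Submodule.subset_span ⟨i, rfl⟩)

section Span

variable {ι : Type*} [Fintype ι] [DecidableEq ι] (β : Basis ι (iterateFrobeniusRange K p e) K)

omit [IsDomain A] [IsFractionRing A K] in
/-- **The Frobenius norm of an F-finite domain is finitely generated**: with generators
`s : Fin n → A` of `A` over `A^q` and `q`-th roots `d_σ` of `det_β(s ∘ σ)` for `σ : ι → Fin n`,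
every element `x` of the Frobenius norm set (`x^q = det_β(m)`, `m ∈ A^ι`) is an `A`-combination
of the `d_σ`: writing `mⱼ = ∑ᵢ c_{ji}^q sᵢ` and expanding multilinearly,
`det_β(m) = ∑_σ (∏ⱼ c_{jσ(j)})^q det_β(s ∘ σ)`, so `x = ∑_σ (∏ⱼ c_{jσ(j)}) d_σ` by uniqueness of
`q`-th roots. [cite: Villamayoru2006, §2] -/
theorem IsFFinite.frobeniusNorm_le_span {n : ℕ} {s : Fin n → A}
    (hs : ∀ a : A, ∃ c : Fin n → A, a = ∑ i, c i ^ p ^ e * s i)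
    (d : (ι → Fin n) → K)
    (hd : ∀ σ, d σ ^ p ^ e = ((β.det fun j => algebraMap A K (s (σ j)) :
      iterateFrobeniusRange K p e) : K)) :
    frobeniusNorm β A ≤ Submodule.span A (Set.range d) := by
  classical
  rw [frobeniusNorm, Submodule.span_le]
  rintro x ⟨m, hm⟩
  choose c hc using fun j => hs (m j)
  let γ : ι → Fin n → iterateFrobeniusRange K p e := fun j i =>
    ⟨algebraMap A K (c j i) ^ p ^ e, pow_mem_iterateFrobeniusRange _⟩
  have hmj : (fun j => algebraMap A K (m j)) = fun j => ∑ i, γ j i • algebraMap A K (s i) := by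
    funext j
    rw [hc j, map_sum]
    refine Finset.sum_congr rfl fun i _ => ?_
    rw [map_mul, map_pow, Algebra.smul_def, Subfield.algebraMap_ofSubfield]
    rfl
  -- multilinear expansion of the determinant
  have hdet : ((β.det fun j => algebraMap A K (m j) : iterateFrobeniusRange K p e) : K) =
      ∑ σ : ι → Fin n, (∏ j, algebraMap A K (c j (σ j))) ^ p ^ e * d σ ^ p ^ e := by
    rw [hmj]
    have h1 := (β.det : MultilinearMap (iterateFrobeniusRange K p e) (fun _ : ι => K)
      (iterateFrobeniusRange K p e)).map_sum (fun j i => γ j i • algebraMap A K (s i))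
    rw [AlternatingMap.coe_multilinearMap] at h1
    rw [h1, AddSubmonoidClass.coe_finsetSum]
    refine Finset.sum_congr rfl fun σ _ => ?_
    have h2 := (β.det : MultilinearMap (iterateFrobeniusRange K p e) (fun _ : ι => K)
      (iterateFrobeniusRange K p e)).map_smul_univ (fun j => γ j (σ j))
      (fun j => algebraMap A K (s (σ j)))
    rw [AlternatingMap.coe_multilinearMap] at h2
    rw [h2, smul_eq_mul, Subfield.coe_mul, SubmonoidClass.coe_finsetProd, ← hd σ,
      ← Finset.prod_pow]
  -- `x = ∑_σ (∏ⱼ c_{jσ(j)}) d_σ` by uniqueness of `q`-th roots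
  have hx : x = ∑ σ : ι → Fin n, (∏ j, algebraMap A K (c j (σ j))) * d σ := by
    apply pow_expChar_pow_injective (K := K) (p := p) (e := e)
    change x ^ p ^ e = (∑ σ : ι → Fin n, (∏ j, algebraMap A K (c j (σ j))) * d σ) ^ p ^ e
    rw [sum_pow_char_pow, hm, hdet]
    refine Finset.sum_congr rfl fun σ _ => ?_
    rw [mul_pow]
  rw [SetLike.mem_coe, hx]
  refine Submodule.sum_mem _ fun σ _ => ?_
  rw [← map_prod, ← Algebra.smul_def]
  exact Submodule.smul_mem _ _ (Submodule.subset_span ⟨σ, rfl⟩)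

/-- **The Frobenius norm of an F-finite domain has a common denominator**: some nonzero
`D ∈ A` with `D · [[F^e_* A]]_β ⊆ A` (inside `K`). [cite: Villamayoru2006, §2] -/
theorem IsFFinite.exists_denominator_frobeniusNorm (h : IsFFinite p e A) :
    ∃ D : A, D ≠ 0 ∧ (frobeniusNorm β A).map (LinearMap.mulLeft A (algebraMap A K D)) ≤
      LinearMap.range (Algebra.linearMap A K) := by
  classical
  obtain ⟨n, s, hs⟩ := h
  -- `q`-th roots of the finitely many determinants, and their denominators
  have hroot : ∀ σ : ι → Fin n, ∃ d : K, d ^ p ^ e =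
      ((β.det fun j => algebraMap A K (s (σ j)) : iterateFrobeniusRange K p e) : K) :=
    fun σ => mem_iterateFrobeniusRange_iff.mp (β.det fun j => algebraMap A K (s (σ j))).2
  choose d hd using hroot
  have hfrac : ∀ σ : ι → Fin n, ∃ nD : A × A, nD.2 ∈ nonZeroDivisors A ∧
      algebraMap A K nD.1 / algebraMap A K nD.2 = d σ := fun σ => by
    obtain ⟨a, b, hb, hab⟩ := IsFractionRing.div_surjective (A := A) (d σ)
    exact ⟨(a, b), hb, hab⟩
  choose nD hnD hnD' using hfrac
  refine ⟨∏ σ, (nD σ).2, ?_, ?_⟩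
  · exact nonZeroDivisors.ne_zero (prod_mem fun σ _ => hnD σ)
  · rw [Submodule.map_le_iff_le_comap]
    refine (IsFFinite.frobeniusNorm_le_span β hs d hd).trans ?_
    rw [Submodule.span_le]
    rintro _ ⟨σ, rfl⟩
    rw [SetLike.mem_coe, Submodule.mem_comap, LinearMap.mulLeft_apply, LinearMap.mem_range]
    refine ⟨(∏ τ ∈ Finset.univ.erase σ, (nD τ).2) * (nD σ).1, ?_⟩
    change algebraMap A K _ = _
    have hD : algebraMap A K (nD σ).2 ≠ 0 :=
      IsFractionRing.to_map_ne_zero_of_mem_nonZeroDivisors (hnD σ)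
    rw [← hnD' σ, map_mul, map_prod, map_prod,
      ← Finset.mul_prod_erase Finset.univ (fun τ => algebraMap A K (nD τ).2) (Finset.mem_univ σ)]
    rw [mul_comm (algebraMap A K (nD σ).2), mul_assoc, mul_div_cancel₀ _ hD]

end Span

/-- **An F-finite domain has a Frobenius norm ideal**: some ideal `I ⊆ A` represents
`[[F^e_* A]]` (`IsFrobeniusNormIdeal K p e I`). With `D` a common denominator of the norm with
respect to a basis `β`, the basis `β'` obtained by multiplying one basis vector by the unit
`(D^q)⁻¹ ∈ K^q` has `det_{β'}(β) = D^q`, so `[[F^e_* A]]_{β'} = D · [[F^e_* A]]_β ⊆ A`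
(`frobeniusNorm_basis_change`), and `I` is its preimage in `A`.
[cite: Villamayoru2006, §2 and Thm. 3.3] -/
theorem IsFFinite.exists_isFrobeniusNormIdeal (h : IsFFinite p e A) :
    ∃ I : Ideal A, IsFrobeniusNormIdeal K p e I := by
  classical
  haveI := h.finite_iterateFrobeniusRange (K := K)
  let β := Module.finBasis (iterateFrobeniusRange K p e) K
  obtain ⟨D, hD0, hD⟩ := h.exists_denominator_frobeniusNorm (K := K) β
  have hv : algebraMap A K D ≠ 0 := fun h0 =>
    hD0 ((injective_iff_map_eq_zero (algebraMap A K)).mp (IsFractionRing.injective A K) D h0)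
  -- the rescaled basis
  have hr : 0 < finrank (iterateFrobeniusRange K p e) K := Module.finrank_pos
  let i₀ : Fin (finrank (iterateFrobeniusRange K p e) K) := ⟨0, hr⟩
  have hu0 : (⟨(algebraMap A K D ^ p ^ e)⁻¹, by
      rw [← inv_pow]; exact pow_mem_iterateFrobeniusRange _⟩ : iterateFrobeniusRange K p e) ≠ 0 :=
    fun h0 => by
      have := congrArg Subtype.val h0
      exact (inv_ne_zero (pow_ne_zero _ hv)) this
  let u : (iterateFrobeniusRange K p e)ˣ := Units.mk0 _ hu0
  let β' := β.unitsSMul (Function.update 1 i₀ u)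
  have hdet : ((β'.det β : iterateFrobeniusRange K p e) : K) = algebraMap A K D ^ p ^ e := by
    rw [Basis.det_unitsSMul, AlternatingMap.smul_apply, β.det_self, smul_eq_mul, mul_one,
      Finset.prod_update_of_mem (Finset.mem_univ i₀)]
    simp only [Pi.one_apply, Finset.prod_const_one, mul_one]
    rw [Units.val_inv_eq_inv_val, Subfield.coe_inv]
    change ((algebraMap A K D ^ p ^ e)⁻¹)⁻¹ = _
    rw [inv_inv]
  -- the norm for `β'` lies in `A`
  have hN : frobeniusNorm β' A ≤ LinearMap.range (Algebra.linearMap A K) := by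
    rw [frobeniusNorm_basis_change β' hdet.symm]
    exact hD
  refine ⟨(frobeniusNorm β' A).comap (Algebra.linearMap A K), _, inferInstance, inferInstance,
    β', ?_⟩
  rw [IsLocalization.coeSubmodule, Submodule.map_comap_eq_self hN]

end Literature.AlgebraicGeometry.Resolution

end
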